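import Literature.AnabelianGeometry.SemiGraphs.ArithMaximalCompact
import HarnessLib

/-!
# [SemiAnbd] §5 (Def 5.3, Rmk 5.3.1, Thm 5.4 (i)(ii)) in the case of the author's Comment (4):
# trivial arithmetic component — kernel INSTANCE FORMS for FACT-LIST rows F-1398 / F-1399 / F-1400 / F-1401

Mochizuki, *Semi-graphs of anabelioids*, Publ. RIMS **42** (2006), §5, Def. 5.3 / Rmk. 5.3.1 p. 65 and
Thm. 5.4 (i), (ii) p. 66 of the author's manuscript [cite: MochizukiSemiAnbd2006, Thm 5.4, p. 66], together
with the author's *Comments on "Semi-graphs of anabelioids"* (May 2020), item (4)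
(cell render `Cmt-SemiAnbd-url-98b6916daf26` p. 1 l. 18–33), VERBATIM: "(4.) Note that in Theorem 5.4,
the case where `A` is trivial [i.e., is equal to the anabelioid associated to the trivial group `{1}`] is
not excluded. Thus, suppose that, in Theorem 5.4, we assume further that `A` is trivial. Then let us
observe that this implies that the underlying graph of `𝔊` [or `ℍ`] consists of a single vertex and no
edges. [Indeed, if the underlying graph of `𝔊` has at least one edge, then since `𝔊` is assumed to be
totally elevated, it follows from the assumption that `𝔊` is totally arithmetically estranged [cf.
Definition 5.3, (ii)] that `Π^temp_𝔊` admits a closed subgroup that fails to be arithmetically ample,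
hence that `Π_A = {1}` contains a closed subgroup which is not open — a contradiction.] Thus, `Π^temp_𝔊`
itself is a verticial subgroup of `Π^temp_𝔊`, hence compact. In particular, `Π^temp_𝔊` is the unique
maximal compact subgroup of `Π^temp_𝔊`, so assertions (i), (ii), and (iii) of Theorem 5.4 are, in
essence, vacuous."

PROOF-ONLY companion (abc-iut cell, block F fact-proving wave, seat abc-iut-f-156, tranche 156 of
`plan/F-TRANCHES.tsv`; no definition, no new named fact, nothing restated) of abc-iut-L3-t3's statement
file `ArithMaximalCompact.lean` (p403878), SECOND PASS after abc-iut-w5-d095's closure census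
`ArithMaximalCompactClosures.lean` (p429184: the universal closures of all four rows are FALSE; toy
instances over the trivial group `PUnit`).  The statement file types Def. 5.3 / Rmk. 5.3.1 / Thm. 5.4
(i)(ii) as predicates on EXPLICIT DATA (`Gtp` for `Π^temp_𝔊`, `PA` for `Π_A`, `aug : Gtp →* PA`, a
`DecompositionData` of chosen decomposition groups); this file records, in the kernel, the ONE instance
of these predicates that print itself names — the erratum's case "`A` trivial":

* `isArithAmple_of_subsingleton` (row F-1401): if `Π_A` is the trivial group, EVERY subgroup of
  `Π^temp_𝔊` is arithmetically ample (its image is all of the one-point space `Π_A`, which is open) —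
  the sentence "`Π_A = {1}` contains [no] closed subgroup which is not open" of (4).
* `IsArithEstrangedEdge.brGp_eq_vertGp_of_subsingleton` / `….eq_of_abut_eq_of_subsingleton`: the
  typed shadow of the bracketed argument of (4) — with `Π_A` trivial, Def. 5.3 (ii) AS TYPED forces,
  for an arithmetically estranged edge, that each of its branches `b` abutting to a vertex `v` is the
  ONLY branch abutting to `v` and has `Π^temp_{𝔊,b} = Π^temp_{𝔊,v}`.  (Print concludes "no edges at all"
  using, in addition, total elevation — `Π_b` of infinite index in `Π_v` — which the typed Def. 5.3 (ii)
  does not carry; the typed predicate is correspondingly weaker and this is exactly what it yields.)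
* `arithMaximalCompactStatementI_of_vertGp_eq_top` (row F-1398): Thm. 5.4 (i) AS TYPED holds for ANY
  data all of whose vertex decomposition groups are `Π^temp_𝔊` itself ("`Π^temp_𝔊` itself is a verticial
  subgroup") and which have at least one vertex — for every `Π_A`, `aug`, topology, with or without
  branches: every subgroup lies in the verticial subgroup `⊤`, and no two verticial subgroups are
  distinct.
* `arithMaximalCompactStatementII_of_vertGp_eq_top` (row F-1399): Thm. 5.4 (ii) AS TYPED holds for such
  data when moreover `Π^temp_𝔊` is compact ("hence compact"), `⊤` is arithmetically ample (automatic for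
  trivial `Π_A`: `…_of_subsingleton`) and there are no branches ("no edges"): the arithmetically maximal
  compact subgroups are exactly `{Π^temp_𝔊}` = the verticial subgroups ("the unique maximal compact
  subgroup"), and both sides of the second sentence are empty.
* `intersectionWithGeometricStatement_of_vertGp_eq_top` (row F-1400): Rmk. 5.3.1, second sentence, AS
  TYPED, for such data, with "verticial subgroup of `Π^temp_𝔾` in the sense of Thm. 3.7" instantiated to
  "equal to `Π^temp_𝔾 = Ker(aug)`" (the one-vertex graph: its geometric tempered group is its own unique
  verticial subgroup) and no geometric edge-like subgroups.
* `verticialEdgeLikeCompactAmple_of_vertGp_eq_top`: Rmk. 5.3.1, first sentence, for the same data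
  (bookkeeping; row F-1396 belongs to another tranche and is not claimed here).

HONEST LABEL.  These are instance forms at DEGENERATE-BUT-PRINTED data (the erratum's case), one step up
from the `PUnit` toys of p429184 (arbitrary compact `Π^temp_𝔊`, arbitrary `Π_A` where stated); they say
nothing about the genuine case (infinite `Π_A`, edges present), whose instance forms remain the CONDITIONAL
theorems of the L3 sub-DAG `plan/L3/SUBDAG-SemiAnbd-Thm54.md` (`arithMaximalCompactStatementI_of_levelData`
p413068, `ArithLevelData.arithMaximalCompactStatementI_of/II_of` p414985, `…_and_II_ofChart` p416011,
`intersectionWithGeometricStatement_of_chart` p413003) modulo producer debt T54-B (GAP G-w4d053-1).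
Compare abc-iut-w4-d059's `ArithMaximalCompactWitness.lean` (O-T54-3): with `Π_A` trivial and THREE
vertices carrying proper vertex groups (disconnected edgeless data) Thm. 5.4 (i) as typed FAILS — the
erratum's "single vertex, `Π^temp_{𝔊,v} = Π^temp_𝔊`" is precisely what separates the two.
Nothing of [SemiAnbd] is asserted or denied beyond OUR kernel check of OUR typed predicates; no side taken
on [IUTchIII] Cor. 3.12; typed ≠ proved.
-/

namespace Literature.AnabelianGeometry.SemiGraphs

universe u u' w w'

variable {Gtp : Type u} [Group Gtp] [TopologicalSpace Gtp]
variable {PA : Type u'} [Group PA] [TopologicalSpace PA]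
variable {V : Type w} {B : Type w'}

/-! ### Row F-1401: with `Π_A` trivial every subgroup is arithmetically ample -/

omit [TopologicalSpace Gtp] in
/-- **Comment (4), the ampleness sentence**: if the arithmetic component `A` is trivial (`Π_A = {1}`),
then EVERY subgroup of `Π^temp_𝔊` is arithmetically ample in the sense of Def. 5.3 (i) — its image in
the one-point space `Π_A` is nonempty, hence everything, hence open ("`Π_A = {1}` contains [no] closed
subgroup which is not open"). [cite: MochizukiSemiAnbd2006, Def 5.3 (i), p. 65] -/
theorem isArithAmple_of_subsingleton [Subsingleton PA] (aug : Gtp →* PA) (K : Subgroup Gtp) :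
    IsArithAmple aug K := by
  unfold IsArithAmple
  rw [Subsingleton.eq_univ_of_nonempty ⟨1, (K.map aug).one_mem⟩]
  exact isOpen_univ

omit [TopologicalSpace Gtp] in
/-- In particular no data over a trivial `Π_A` has a non-ample subgroup: the negation
`¬ IsArithAmple aug K` never holds. [cite: MochizukiSemiAnbd2006, Def 5.3 (i), p. 65] -/
theorem not_not_isArithAmple_of_subsingleton [Subsingleton PA] (aug : Gtp →* PA) (K : Subgroup Gtp) :
    ¬ ¬ IsArithAmple aug K :=
  fun h => h (isArithAmple_of_subsingleton aug K)

/-! ### The bracketed argument of Comment (4), typed shadow (Def. 5.3 (ii) over a trivial `Π_A`) -/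

omit [TopologicalSpace Gtp] in
/-- **Comment (4), bracketed argument (typed shadow), first half**: over a trivial `Π_A`, if the edge `e`
is arithmetically estranged AS TYPED (Def. 5.3 (ii): certain intersections "fail to be arithmetically
ample" — impossible here), then for every branch `b` of `e` abutting to a vertex `v` one has
`Π^temp_{𝔊,b} = Π^temp_{𝔊,v}` (the clause "`b' = b` and `g ∉ Π^temp_{𝔊,b}`" can never be triggered, so
`Π^temp_{𝔊,v} ⊆ Π^temp_{𝔊,b}`).  In print, total elevation makes this absurd, whence "no edges".
[cite: MochizukiSemiAnbd2006, Def 5.3 (ii), p. 65] -/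
theorem IsArithEstrangedEdge.brGp_eq_vertGp_of_subsingleton [Subsingleton PA]
    {D : DecompositionData Gtp V B} {aug : Gtp →* PA} {e : D.E} (he : IsArithEstrangedEdge D aug e)
    (b : B) (hb : D.edgeOf b = e) (v : V) (hv : D.abut b = some v) : D.brGp b = D.vertGp v := by
  refine le_antisymm (D.brGp_le_vertGp b v hv) fun g hg => ?_
  by_contra hgb
  exact ((he b hb v hv g hg).2 hgb) (isArithAmple_of_subsingleton aug _)

omit [TopologicalSpace Gtp] in
/-- **Comment (4), bracketed argument (typed shadow), second half**: over a trivial `Π_A`, a branch `b`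
of an arithmetically estranged edge that abuts to `v` is the ONLY branch abutting to `v` (for any other
`b'` the intersection `Π^temp_{𝔊,b} ∩ 1·Π^temp_{𝔊,b'}·1⁻¹` would have to fail to be ample).
[cite: MochizukiSemiAnbd2006, Def 5.3 (ii), p. 65] -/
theorem IsArithEstrangedEdge.eq_of_abut_eq_of_subsingleton [Subsingleton PA]
    {D : DecompositionData Gtp V B} {aug : Gtp →* PA} {e : D.E} (he : IsArithEstrangedEdge D aug e)
    (b : B) (hb : D.edgeOf b = e) (v : V) (hv : D.abut b = some v) (b' : B)
    (hb' : D.abut b' = some v) : b' = b := by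
  by_contra hne
  exact ((he b hb v hv 1 (D.vertGp v).one_mem).1 b' hb' hne) (isArithAmple_of_subsingleton aug _)

omit [TopologicalSpace Gtp] in
/-- Hence, over a trivial `Π_A`, TOTAL arithmetic estrangement as typed says: every branch abutting to a
vertex is solitary there and carries the full vertex group. [cite: MochizukiSemiAnbd2006, Def 5.3 (ii), p. 65] -/
theorem IsTotallyArithEstranged.branches_of_subsingleton [Subsingleton PA]
    {D : DecompositionData Gtp V B} {aug : Gtp →* PA} (h : IsTotallyArithEstranged D aug)
    (b : B) (v : V) (hv : D.abut b = some v) :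
    D.brGp b = D.vertGp v ∧ ∀ b' : B, D.abut b' = some v → b' = b :=
  ⟨(h (D.edgeOf b)).brGp_eq_vertGp_of_subsingleton b rfl v hv,
    fun b' hb' => (h (D.edgeOf b)).eq_of_abut_eq_of_subsingleton b rfl v hv b' hb'⟩

/-! ### "`Π^temp_𝔊` itself is a verticial subgroup": data with vertex groups `⊤` -/

omit [TopologicalSpace Gtp] in
/-- Conjugating the whole group gives the whole group. [folklore] -/
private theorem conjSubgroup_top' (g : Gtp) : conjSubgroup g (⊤ : Subgroup Gtp) = ⊤ :=
  Subgroup.map_top_of_surjective _ (MulAut.conj g).surjective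

omit [TopologicalSpace Gtp] in
/-- If every vertex decomposition group is `Π^temp_𝔊` itself, the verticial subgroups are exactly `{⊤}`
(given at least one vertex). [cite: MochizukiSemiAnbd2006, Def 5.3 (iii), p. 65] -/
theorem isVerticial_iff_eq_top_of_vertGp_eq_top [Nonempty V] (D : DecompositionData Gtp V B)
    (hV : ∀ v : V, D.vertGp v = ⊤) (K : Subgroup Gtp) : IsVerticial D K ↔ K = ⊤ := by
  constructor
  · rintro ⟨v, g, rfl⟩
    rw [hV v, conjSubgroup_top']
  · rintro rfl
    obtain ⟨v⟩ := ‹Nonempty V›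
    exact ⟨v, 1, by rw [hV v, conjSubgroup_top']⟩

omit [TopologicalSpace Gtp] in
/-- With no branches there are no edge-like subgroups. [cite: MochizukiSemiAnbd2006, Def 5.3 (iii), p. 65] -/
theorem not_isEdgeLike_of_isEmpty [IsEmpty B] (D : DecompositionData Gtp V B) (K : Subgroup Gtp) :
    ¬ IsEdgeLike D K := by
  rintro ⟨b, -, -⟩
  exact isEmptyElim b

/-! ### Row F-1398: Thm 5.4 (i) in the erratum's case -/

/-- **Thm. 5.4 (i) as typed, in the case of Comment (4)** ("`Π^temp_𝔊` itself is a verticial subgroup"):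
for ANY data with at least one vertex all of whose vertex decomposition groups are `Π^temp_𝔊` — any
`Π_A`, any augmentation, any topology, branches or not — `ArithMaximalCompactStatementI` holds: every
(compact, arithmetically ample) subgroup lies in the verticial subgroup `Π^temp_𝔊`, and the clause about
"more than one verticial subgroup" is never triggered since all verticial subgroups coincide.
[cite: MochizukiSemiAnbd2006, Thm 5.4 (i), p. 66] -/
theorem arithMaximalCompactStatementI_of_vertGp_eq_top [Nonempty V] (D : DecompositionData Gtp V B)
    (aug : Gtp →* PA) (hV : ∀ v : V, D.vertGp v = ⊤) :
    Literature.AnabelianGeometry.SemiGraphs.ArithMaximalCompactStatementI D aug := by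
  intro K _ _
  refine ⟨⟨⊤, (isVerticial_iff_eq_top_of_vertGp_eq_top D hV ⊤).2 rfl, le_top⟩, ?_⟩
  intro W₁ W₂ h₁ h₂ hne
  exact absurd (((isVerticial_iff_eq_top_of_vertGp_eq_top D hV W₁).1 h₁).trans
    ((isVerticial_iff_eq_top_of_vertGp_eq_top D hV W₂).1 h₂).symm) hne

/-! ### Row F-1399: Thm 5.4 (ii) in the erratum's case -/

/-- With `Π^temp_𝔊` compact and `⊤` arithmetically ample, the arithmetically maximal compact subgroups
are exactly `{Π^temp_𝔊}` ("the unique maximal compact subgroup").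
[cite: MochizukiSemiAnbd2006, Def 5.3 (i), p. 65] -/
theorem isArithMaximalCompact_iff_eq_top [CompactSpace Gtp] (aug : Gtp →* PA)
    (htop : IsArithAmple aug ⊤) (K : Subgroup Gtp) : IsArithMaximalCompact aug K ↔ K = ⊤ := by
  have hc : IsCompact ((⊤ : Subgroup Gtp) : Set Gtp) := by
    rw [Subgroup.coe_top]
    exact isCompact_univ
  constructor
  · intro hK
    exact (hK.2.2 ⊤ hc htop le_top).symm
  · rintro rfl
    exact ⟨hc, htop, fun K' _ _ hle => top_le_iff.mp hle⟩

/-- **Thm. 5.4 (ii) as typed, in the case of Comment (4)**: for data with at least one vertex, all vertex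
decomposition groups equal to `Π^temp_𝔊`, NO branches ("no edges"), `Π^temp_𝔊` compact ("hence compact")
and `⊤` arithmetically ample (automatic over a trivial `Π_A`, `isArithAmple_of_subsingleton`; in general
it says `aug` has open image), `ArithMaximalCompactStatementII` holds: "the arithmetically maximal compact
subgroups are precisely the verticial subgroups" reads `{Π^temp_𝔊} = {Π^temp_𝔊}`, and both sides of the
second sentence are empty (no two distinct maximal compact subgroups; no edge-like subgroups).
[cite: MochizukiSemiAnbd2006, Thm 5.4 (ii), p. 66] -/
theorem arithMaximalCompactStatementII_of_vertGp_eq_top [CompactSpace Gtp] [Nonempty V] [IsEmpty B]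
    (D : DecompositionData Gtp V B) (aug : Gtp →* PA) (hV : ∀ v : V, D.vertGp v = ⊤)
    (htop : IsArithAmple aug ⊤) :
    Literature.AnabelianGeometry.SemiGraphs.ArithMaximalCompactStatementII D aug := by
  refine ⟨fun K => (isArithMaximalCompact_iff_eq_top aug htop K).trans
      (isVerticial_iff_eq_top_of_vertGp_eq_top D hV K).symm, fun K => ⟨?_, ?_⟩⟩
  · rintro ⟨-, M₁, M₂, h₁, h₂, hne, -⟩
    exact absurd (((isArithMaximalCompact_iff_eq_top aug htop M₁).1 h₁).trans
      ((isArithMaximalCompact_iff_eq_top aug htop M₂).1 h₂).symm) hne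
  · exact fun h => absurd h (not_isEdgeLike_of_isEmpty D K)

/-- The same over a TRIVIAL `Π_A` (the literal case of Comment (4)): no ampleness hypothesis is left.
[cite: MochizukiSemiAnbd2006, Thm 5.4 (ii), p. 66] -/
theorem arithMaximalCompactStatementII_of_vertGp_eq_top_of_subsingleton [CompactSpace Gtp]
    [Subsingleton PA] [Nonempty V] [IsEmpty B] (D : DecompositionData Gtp V B) (aug : Gtp →* PA)
    (hV : ∀ v : V, D.vertGp v = ⊤) :
    Literature.AnabelianGeometry.SemiGraphs.ArithMaximalCompactStatementII D aug :=
  arithMaximalCompactStatementII_of_vertGp_eq_top D aug hV (isArithAmple_of_subsingleton aug ⊤)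

/-! ### Row F-1400 and Rmk 5.3.1 in the erratum's case -/

omit [TopologicalSpace Gtp] [TopologicalSpace PA] in
/-- **Rmk. 5.3.1, second sentence, as typed, in the case of Comment (4)**: for data with at least one
vertex, all vertex groups `Π^temp_𝔊` and no branches, with "verticial subgroup of `Π^temp_𝔾` in the sense
of Thm. 3.7" instantiated to "equal to `Π^temp_𝔾 = Ker(Π^temp_𝔊 ↠ Π_A)`" (the one-vertex, edge-free graph:
its geometric tempered group is its own unique verticial subgroup) and no geometric edge-like subgroups,
`IntersectionWithGeometricStatement` holds: `Π^temp_𝔊 ∩ Π^temp_𝔾 = Π^temp_𝔾`.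
[cite: MochizukiSemiAnbd2006, Rmk 5.3.1, p. 65] -/
theorem intersectionWithGeometricStatement_of_vertGp_eq_top [Nonempty V] [IsEmpty B]
    (D : DecompositionData Gtp V B) (aug : Gtp →* PA) (hV : ∀ v : V, D.vertGp v = ⊤) :
    Literature.AnabelianGeometry.SemiGraphs.IntersectionWithGeometricStatement D aug
      (fun K => K = aug.ker) (fun _ => False) := by
  refine ⟨fun K hK => ?_, fun K hK => not_isEdgeLike_of_isEmpty D K hK⟩
  rw [(isVerticial_iff_eq_top_of_vertGp_eq_top D hV K).1 hK, top_inf_eq]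

/-- **Rmk. 5.3.1, first sentence, as typed, in the case of Comment (4)**: for data with at least one
vertex, all vertex groups `Π^temp_𝔊`, no branches, `Π^temp_𝔊` compact and `⊤` arithmetically ample, "all
verticial and edge-like subgroups are compact and arithmetically ample" (the only such subgroup is
`Π^temp_𝔊`). [cite: MochizukiSemiAnbd2006, Rmk 5.3.1, p. 65] -/
theorem verticialEdgeLikeCompactAmple_of_vertGp_eq_top [CompactSpace Gtp] [Nonempty V] [IsEmpty B]
    (D : DecompositionData Gtp V B) (aug : Gtp →* PA) (hV : ∀ v : V, D.vertGp v = ⊤)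
    (htop : IsArithAmple aug ⊤) :
    Literature.AnabelianGeometry.SemiGraphs.VerticialEdgeLikeCompactAmpleStatement D aug := by
  intro K hK
  rcases hK with hK | hK
  · rw [(isVerticial_iff_eq_top_of_vertGp_eq_top D hV K).1 hK, Subgroup.coe_top]
    exact ⟨isCompact_univ, htop⟩
  · exact absurd hK (not_isEdgeLike_of_isEmpty D K)

/-! ### Summary: the erratum's configuration versus O-T54-3 -/

/-- **Summary (kernel status of Thm. 5.4 (i)(ii) as typed over a trivial `Π_A`).**  In the erratum's
configuration — one (or more) vertices each with decomposition group `Π^temp_𝔊`, no branches, `Π^temp_𝔊`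
compact — BOTH typed statements hold for every augmentation to a trivial `Π_A`; by contrast
abc-iut-w4-d059's `ArithMaximalCompactWitness.exists_not_arithMaximalCompactStatementI` exhibits edgeless
data over a trivial `Π_A` with three vertices carrying PROPER vertex groups where (i) fails.  So over a
trivial arithmetic component the typed rows hold exactly in the shape Comment (4) derives from the
remaining hypotheses of Thm. 5.4. [cite: MochizukiSemiAnbd2006, Thm 5.4, p. 66] -/
theorem arithMaximalCompactStatements_of_vertGp_eq_top_of_subsingleton [CompactSpace Gtp]
    [Subsingleton PA] [Nonempty V] [IsEmpty B] (D : DecompositionData Gtp V B) (aug : Gtp →* PA)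
    (hV : ∀ v : V, D.vertGp v = ⊤) :
    Literature.AnabelianGeometry.SemiGraphs.ArithMaximalCompactStatementI D aug ∧
      Literature.AnabelianGeometry.SemiGraphs.ArithMaximalCompactStatementII D aug ∧
        Literature.AnabelianGeometry.SemiGraphs.VerticialEdgeLikeCompactAmpleStatement D aug ∧
          Literature.AnabelianGeometry.SemiGraphs.IsTotallyArithEstranged D aug :=
  ⟨arithMaximalCompactStatementI_of_vertGp_eq_top D aug hV,
    arithMaximalCompactStatementII_of_vertGp_eq_top_of_subsingleton D aug hV,
    verticialEdgeLikeCompactAmple_of_vertGp_eq_top D aug hV (isArithAmple_of_subsingleton aug ⊤),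
    fun _ b _ _ _ => isEmptyElim b⟩

end Literature.AnabelianGeometry.SemiGraphs

/-!
### Appendix (v2, same seat): Comment (4), NON-degenerate direction — a genuine estranged edge forces
### `Π_A` non-discrete, i.e. discharges the binder `hbot : ¬ IsArithAmple aug ⊥` of the Thm 5.4 assemblies

The bracketed argument of Comment (4) read contrapositively and WITHOUT assuming `A` trivial: "if the
underlying graph of `𝔊` has at least one edge, then [by total elevation and] total arithmetic estrangement
`Π^temp_𝔊` admits a closed subgroup that fails to be arithmetically ample", hence — arithmetic ampleness
being upward closed (Def. 5.3 (i): the image contains an open subgroup) — the trivial subgroup is NOT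
arithmetically ample, i.e. `{1}` is not open in `Π_A`.  In the typed Def. 5.3 (ii) the role of total
elevation ("`Π_b ≠ Π_v`") is played by the explicit side condition that the branch `b` at `v` is GENUINE:
`Π^temp_{𝔊,b} ≠ Π^temp_{𝔊,v}` or a second branch abuts to `v` (at produced chart data the former is
abc-iut-w4-d053's `decompositionDataOfChart_brGp_ne_vertGp`, p415279).  Consequence for the cell's
packaged Thm. 5.4 (i)(ii) (`ArithLevelData.arithMaximalCompactStatementI_of (L) (habuts) (hest) (hbot)`,
p414985; `arithMaximalCompactStatementI_and_II_ofChart … hest hbot …`, p416011): whenever the graph has a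
genuine edge, `hbot` FOLLOWS from `hest` (`IsTotallyArithEstranged.not_isArithAmple_bot`) and need not be
supplied from "`Π_A` compact infinite" (abc-iut-w4-d098's `not_isArithAmple_bot_of_compactSpace`); in the
edgeless case the statements hold outright in the erratum's configuration (the theorems above).
-/

namespace Literature.AnabelianGeometry.SemiGraphs

universe u₂ u₂' w₂ w₂'

variable {Gtp : Type u₂} [Group Gtp] {PA : Type u₂'} [Group PA] [TopologicalSpace PA]
variable {V : Type w₂} {B : Type w₂'}

/-- **Comment (4), bracketed argument, general form**: if the edge `e` is arithmetically estranged (Def.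
5.3 (ii) as typed) and one of its branches `b` abuts to a vertex `v` GENUINELY — `Π^temp_{𝔊,b} ≠ Π^temp_{𝔊,v}`
(print: total elevation) or some other branch `b' ≠ b` also abuts to `v` — then `Π^temp_𝔊` "admits a
closed subgroup that fails to be arithmetically ample" (namely `Π_b ∩ g·Π_b·g⁻¹` for `g ∈ Π_v ∖ Π_b`, resp.
`Π_b ∩ Π_{b'}`). [cite: MochizukiSemiAnbd2006, Def 5.3 (ii), p. 65] -/
theorem IsArithEstrangedEdge.exists_not_isArithAmple {D : DecompositionData Gtp V B} {aug : Gtp →* PA}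
    {e : D.E} (he : IsArithEstrangedEdge D aug e) (b : B) (hb : D.edgeOf b = e) (v : V)
    (hv : D.abut b = some v) (hgen : D.brGp b ≠ D.vertGp v ∨ ∃ b' : B, D.abut b' = some v ∧ b' ≠ b) :
    ∃ K : Subgroup Gtp, ¬ IsArithAmple aug K := by
  rcases hgen with hne | ⟨b', hb', hne⟩
  · have hnle : ¬ D.vertGp v ≤ D.brGp b := fun hle =>
      hne (le_antisymm (D.brGp_le_vertGp b v hv) hle)
    obtain ⟨g, hgv, hgb⟩ := SetLike.not_le_iff_exists.mp hnle
    exact ⟨_, (he b hb v hv g hgv).2 hgb⟩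
  · exact ⟨_, (he b hb v hv 1 (D.vertGp v).one_mem).1 b' hb' hne⟩

/-- **Hence `⊥` is not arithmetically ample** (arithmetic ampleness is upward closed: Def. 5.3 (i)) —
the binder `hbot` of the cell's Thm. 5.4 assemblies, discharged from ONE genuinely abutting branch of an
arithmetically estranged edge. [cite: MochizukiSemiAnbd2006, Def 5.3 (ii), p. 65] -/
theorem IsArithEstrangedEdge.not_isArithAmple_bot [ContinuousMul PA] {D : DecompositionData Gtp V B}
    {aug : Gtp →* PA} {e : D.E} (he : IsArithEstrangedEdge D aug e) (b : B) (hb : D.edgeOf b = e)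
    (v : V) (hv : D.abut b = some v)
    (hgen : D.brGp b ≠ D.vertGp v ∨ ∃ b' : B, D.abut b' = some v ∧ b' ≠ b) :
    ¬ IsArithAmple aug (⊥ : Subgroup Gtp) := fun hbot => by
  obtain ⟨K, hK⟩ := he.exists_not_isArithAmple b hb v hv hgen
  exact hK (Subgroup.isOpen_mono (Subgroup.map_mono bot_le) hbot)

/-- **Total arithmetic estrangement + one genuine abutting branch ⇒ `¬ IsArithAmple aug ⊥`** (the form
the packaged theorems `ArithLevelData.arithMaximalCompactStatementI_of/II_of` consume as `hbot`).
[cite: MochizukiSemiAnbd2006, Def 5.3 (ii), p. 65] -/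
theorem IsTotallyArithEstranged.not_isArithAmple_bot [ContinuousMul PA] {D : DecompositionData Gtp V B}
    {aug : Gtp →* PA} (h : IsTotallyArithEstranged D aug) (b : B) (v : V) (hv : D.abut b = some v)
    (hgen : D.brGp b ≠ D.vertGp v ∨ ∃ b' : B, D.abut b' = some v ∧ b' ≠ b) :
    ¬ IsArithAmple aug (⊥ : Subgroup Gtp) :=
  (h (D.edgeOf b)).not_isArithAmple_bot b rfl v hv hgen

/-- … equivalently, `Π_A` is NOT discrete ("`Π_A = {1}` [would] contain a closed subgroup which is not
open — a contradiction": Comment (4) says exactly that a trivial — more generally a discrete — `Π_A` is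
incompatible with a genuine estranged edge). [cite: MochizukiSemiAnbd2006, Def 5.3 (ii), p. 65] -/
theorem IsTotallyArithEstranged.not_discreteTopology [ContinuousMul PA] {D : DecompositionData Gtp V B}
    {aug : Gtp →* PA} (h : IsTotallyArithEstranged D aug) (b : B) (v : V) (hv : D.abut b = some v)
    (hgen : D.brGp b ≠ D.vertGp v ∨ ∃ b' : B, D.abut b' = some v ∧ b' ≠ b) :
    ¬ DiscreteTopology PA := fun _ =>
  h.not_isArithAmple_bot b v hv hgen (isOpen_discrete _)

/-- In particular a TRIVIAL `Π_A` admits no data with a genuinely abutting branch of an arithmetically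
estranged edge — the contrapositive packaging of `IsTotallyArithEstranged.branches_of_subsingleton`
("this implies that the underlying graph … consists of a single vertex and no edges").
[cite: MochizukiSemiAnbd2006, Thm 5.4, p. 66] -/
theorem IsTotallyArithEstranged.false_of_subsingleton_of_genuine [Subsingleton PA]
    {D : DecompositionData Gtp V B} {aug : Gtp →* PA} (h : IsTotallyArithEstranged D aug) (b : B)
    (v : V) (hv : D.abut b = some v)
    (hgen : D.brGp b ≠ D.vertGp v ∨ ∃ b' : B, D.abut b' = some v ∧ b' ≠ b) : False := by
  obtain ⟨K, hK⟩ := (h (D.edgeOf b)).exists_not_isArithAmple b rfl v hv hgen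
  exact hK (isArithAmple_of_subsingleton aug K)

end Literature.AnabelianGeometry.SemiGraphs
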